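import Summits.QuantumFields.YangMills.Theorems.BalabanUVNodesN15KingModelPotentialComplex
import Mathlib.Analysis.Analytic.Constructions
import Mathlib.Analysis.Analytic.Linear

/-!
# N15 (NE2) King-model rung, PART 29 — [B9] THEOREM 3.4 IN ITS MULTI-VARIABLE FORM: King's dressed objects are ANALYTIC functions of a
# COMPLEX POTENTIAL on the sup-norm ball, and satisfy the same inequalities there

Tenth generation (g10) of the seat `pub-ymgap-dag-n15-d`, part 29 (on part 28b `…PotentialComplex`).  Part 28 made the coupling complex along ONE line
(`z·w`, `w` real).  Bałaban's Theorem 3.4 of [B9] is about COMPLEX CONFIGURATIONS: «the operators … extend to configurations U′U … as analytic functions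
of A», `A` ranging over a sup-norm ball of the complexified Lie algebra.  The faithful King-model analogue is a COMPLEX potential `w : X → ℂ` on the
fine torus with `‖w‖_∞ = sup_x ‖w x‖` small, and ANALYTICITY in the Banach-space sense (`AnalyticAt ℂ` on `X → ℂ`, Mathlib's power-series notion):

* §1 GENERIC (any complex normed space `E` of parameters): for an entrywise-analytic matrix family `M : E → Matrix n n ℂ`, `det`, the adjugate entries
  and — at a point where `M` is invertible — every entry of `M⁻¹` are analytic (`analyticAt_inv_apply_of_entries`; Cramer's rule with Mathlib's
  `Finset.analyticAt_fun_sum∕prod` and `AnalyticAt.inv`; the multi-variable twin of 28a's `differentiableAt_inv_apply_of_entries`);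
  the form of a complex diagonal `‖⟨x̄, diag(w)x⟩‖ ≤ w₀·nsq x`, `‖diag(w)v‖₂ ≤ w₀‖v‖₂` for `‖w_i‖ ≤ w₀`;
* §2 King at a COMPLEX POTENTIAL: `fineOpCPot w = A₀ + diag w`, `effLaplacianCPot w`, `kingLevelCPot k w = Δ^{(k)}_w`, `kingCovCPot k w = (Δ^{(k)}_w + aL⁻²Q*Q)⁻¹`;
  28b's objects are the restrictions to complex lines (`fineOpCPot_smul`, `kingCovCPot_smul`); `Re`-coercivity `m² − w₀` of `A₀ + diag w`
  (`reCoercive_fineOpCPot`), the form bound `‖⟨x̄,(Δ_w − Δ_0)x⟩‖ ≤ (2a²∕m⁴)w₀·nsq x` (`norm_form_effLaplacianCPot_sub_le`), `Re`-coercivity `γ₀∕2` of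
  `Δ^{(k)}_w + aL⁻²Q*Q` on `‖w‖_∞ ≤ r_K` and ★★ `kingCovCPot_apply_norm_le`: `‖C^{(k)}_w(x,y)‖ ≤ 2∕γ₀` for EVERY complex potential in the closed sup-ball
  `r_K` (uniform in k, volume) — «the extended operators satisfy all the inequalities»;
* §3 ★★★ `analyticAt_kingCovCPot_apply`: for `‖w₀‖_∞ ≤ r_K`, `AnalyticAt ℂ (fun w => C^{(k)}_w(x,y)) w₀` — every entry of the dressed covariance is an
  ANALYTIC function of the complex potential (jointly in all `N^{d+1}·|torus|` variables); `analyticAt_kingLevelCPot_apply` likewise for the levels on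
  `‖w₀‖_∞ < m²`; hence `analyticOnNhd_kingCovCPot_apply` on the open sup-ball.

PRINTED ANCHOR (template). [B9] = T. Bałaban, Commun. Math. Phys. **99** (1985) 389–434, Theorem 3.4 p. 400 («There exists a positive constant a₁ such that
the operators G(U), (Q′(U)G′²(U)Q′*(U))⁻¹, R(U), … extend to configurations U′U for α₁ ≤ a₁ as analytic functions of A. The extended operators satisfy all
the inequalities of Theorems 3.1–3.3»), (3.64)–(3.65) p. 402.  King's model: C. King, Commun. Math. Phys. **102** (1986) 649–677, (2.13)–(2.14) p. 653,
(4.5) p. 670, (4.32)–(4.33) p. 674 (A = 0).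

HONEST SCOPE.  King's A = 0 SCALAR block-spin tower on an arbitrary unit torus (`L ≥ 2`, `a, m² > 0`, `k ≥ 1`); a complex potential is a complex
MASS insertion, NOT a gauge field and NOT Bałaban's `U′U = e^{iηA}U`; per-LEVEL analyticity with k-uniform bounds (the joint analyticity of the
`k → ∞` LIMIT in `w` would need Hartogs∕Osgood, not in Mathlib — part 28d has the one-variable limit); no decay off the real potentials; NOT a
node discharge; count-neutral.  No `sorry`, standard axioms, default heartbeats.
-/

noncomputable section

open scoped BigOperators Matrix ComplexConjugate
open Finset

namespace Summit.QuantumFields.YangMills.BalabanUVNodes.N15.KingModel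

open Literature.MathematicalPhysics.QuantumFieldTheory.Balaban1983to89 hiding blockOf
open Literature.MathematicalPhysics.QuantumFieldTheory.Balaban1983to89.QGQInverse (Coercive)
open Literature.MathematicalPhysics.QuantumFieldTheory.Balaban1983to89.B5Prop11Plancherel (Tor fine)
open Literature.MathematicalPhysics.QuantumFieldTheory.Balaban1983to89.B5Prop11Lower (nsq nsq_nonneg norm_star_dotProduct_le)
open Literature.MathematicalPhysics.QuantumFieldTheory.King1986 (aK aK_pos aK_le)
open Literature.MathematicalPhysics.QuantumFieldTheory.King1986.Torus (fineOp fineOp_coercive effLaplacian Qmat gam0L gam0L_pos)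
open Summit.QuantumFields.BalabanUV.T4Continuum.UnitaryCayley (inv_sub_inv_eq)

variable {d : ℕ}

/-! ## §1 Generic: analytic matrix families and complex diagonals -/

section Generic

variable {n : Type*} [Fintype n] [DecidableEq n] {E : Type*} [NormedAddCommGroup E] [NormedSpace ℂ E] {M : E → Matrix n n ℂ} {w₀ : E}

/-- **The determinant of an entrywise ANALYTIC matrix family is analytic** (Leibniz expansion). [folklore] -/
theorem analyticAt_det_of_entries (hM : ∀ i j, AnalyticAt ℂ (fun w => M w i j) w₀) : AnalyticAt ℂ (fun w => (M w).det) w₀ := by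
  have hfun : (fun w => (M w).det) = fun w => ∑ σ : Equiv.Perm n, ((Equiv.Perm.sign σ : ℤ) : ℂ) * ∏ i, M w (σ i) i := by
    funext w; exact Matrix.det_apply' (M w)
  rw [hfun]
  refine Finset.analyticAt_fun_sum _ fun σ _ => ?_
  exact analyticAt_const.mul (Finset.analyticAt_fun_prod (f := fun i w => M w (σ i) i) _ fun i _ => hM (σ i) i)

/-- **Every adjugate entry of an entrywise analytic matrix family is analytic.** [folklore] -/
theorem analyticAt_adjugate_apply_of_entries (hM : ∀ i j, AnalyticAt ℂ (fun w => M w i j) w₀) (i j : n) :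
    AnalyticAt ℂ (fun w => (M w).adjugate i j) w₀ := by
  have hfun : (fun w => (M w).adjugate i j) = fun w => ((M w).updateRow j (Pi.single i 1)).det := by
    funext w; exact Matrix.adjugate_apply (M w) i j
  rw [hfun]
  refine analyticAt_det_of_entries (M := fun w => (M w).updateRow j (Pi.single i 1)) fun i' j' => ?_
  by_cases hi : i' = j
  · simp only [Matrix.updateRow_apply, if_pos hi]
    exact analyticAt_const
  · simp only [Matrix.updateRow_apply, if_neg hi]
    exact hM i' j'

/-- **EVERY ENTRY OF THE INVERSE OF AN ENTRYWISE ANALYTIC MATRIX FAMILY IS ANALYTIC AT AN INVERTIBLE POINT** (Cramer's rule; the multi-variable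
twin of 28a's `differentiableAt_inv_apply_of_entries`). [folklore] -/
theorem analyticAt_inv_apply_of_entries (hM : ∀ i j, AnalyticAt ℂ (fun w => M w i j) w₀) (hU : IsUnit (M w₀).det) (i j : n) :
    AnalyticAt ℂ (fun w => (M w)⁻¹ i j) w₀ := by
  have hfun : (fun w => (M w)⁻¹ i j) = fun w => ((M w).det)⁻¹ * (M w).adjugate i j := by
    funext w
    have h := congrFun (congrFun (Matrix.inv_def (M w)) i) j
    rw [h, Matrix.smul_apply, smul_eq_mul, Ring.inverse_eq_inv']
  rw [hfun]
  exact ((analyticAt_det_of_entries hM).inv hU.ne_zero).mul (analyticAt_adjugate_apply_of_entries hM i j)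

omit [DecidableEq n] in
/-- The coordinate `w ↦ w x` of a complex potential is analytic (a continuous linear form). [folklore] -/
theorem analyticAt_apply_coord (x : n) (w₀ : n → ℂ) : AnalyticAt ℂ (fun w : n → ℂ => w x) w₀ :=
  (ContinuousLinearMap.proj (R := ℂ) (φ := fun _ : n => ℂ) x).analyticAt w₀

/-- **Form bound of a complex diagonal**: `‖⟨x̄, diag(w)x⟩‖ ≤ w₀·nsq x` when `‖w_i‖ ≤ w₀`. [folklore] -/
theorem norm_form_diagonal_le {w : n → ℂ} {w₀ : ℝ} (hw : ∀ i, ‖w i‖ ≤ w₀) (x : n → ℂ) :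
    ‖star x ⬝ᵥ Matrix.diagonal w *ᵥ x‖ ≤ w₀ * nsq x := by
  have hform : star x ⬝ᵥ Matrix.diagonal w *ᵥ x = ∑ i, w i * (‖x i‖ ^ 2 : ℝ) := by
    simp only [dotProduct, Matrix.mulVec_diagonal, Pi.star_apply, Complex.star_def]
    exact sum_congr rfl fun i _ => by
      rw [Complex.ofReal_pow, ← Complex.conj_mul']
      ring
  rw [hform]
  calc ‖∑ i, w i * ((‖x i‖ ^ 2 : ℝ) : ℂ)‖ ≤ ∑ i, ‖w i * ((‖x i‖ ^ 2 : ℝ) : ℂ)‖ := norm_sum_le _ _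
    _ ≤ ∑ i, w₀ * ‖x i‖ ^ 2 := sum_le_sum fun i _ => by
        rw [norm_mul, Complex.norm_real, Real.norm_eq_abs, abs_of_nonneg (sq_nonneg ‖x i‖)]
        exact mul_le_mul_of_nonneg_right (hw i) (sq_nonneg _)
    _ = w₀ * nsq x := by rw [nsq, mul_sum]

/-- `‖diag(w)v‖₂ ≤ w₀‖v‖₂` for `‖w_i‖ ≤ w₀`, `w₀ ≥ 0`. [folklore] -/
theorem sqrt_nsq_diagonal_mulVec_le {w : n → ℂ} {w₀ : ℝ} (hw₀ : 0 ≤ w₀) (hw : ∀ i, ‖w i‖ ≤ w₀) (v : n → ℂ) :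
    Real.sqrt (nsq (Matrix.diagonal w *ᵥ v)) ≤ w₀ * Real.sqrt (nsq v) := by
  have h : nsq (Matrix.diagonal w *ᵥ v) ≤ w₀ ^ 2 * nsq v := by
    unfold nsq
    rw [mul_sum]
    refine sum_le_sum fun i _ => ?_
    rw [Matrix.mulVec_diagonal, norm_mul]
    calc (‖w i‖ * ‖v i‖) ^ 2 ≤ (w₀ * ‖v i‖) ^ 2 :=
        pow_le_pow_left₀ (by positivity) (mul_le_mul_of_nonneg_right (hw i) (norm_nonneg _)) 2
      _ = w₀ ^ 2 * ‖v i‖ ^ 2 := by ring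
  calc Real.sqrt (nsq (Matrix.diagonal w *ᵥ v)) ≤ Real.sqrt (w₀ ^ 2 * nsq v) := Real.sqrt_le_sqrt h
    _ = w₀ * Real.sqrt (nsq v) := by rw [Real.sqrt_mul (sq_nonneg _), Real.sqrt_sq hw₀]

omit [DecidableEq n] in
/-- The sup norm of a complex potential bounds every coordinate: `‖w x‖ ≤ ‖w‖`. [folklore] -/
theorem norm_apply_le_pi_norm (w : n → ℂ) (x : n) : ‖w x‖ ≤ ‖w‖ := norm_le_pi_norm w x

end Generic

/-! ## §2 King's fine operator, effective Laplacian and dressed covariance at a COMPLEX potential -/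

section Fine

variable (N : ℕ) [NeZero N] (U : Fin (d + 1) → ℕ) [∀ μ, NeZero (U μ)] (a c m2 : ℝ)

/-- **KING'S FINE-LATTICE OPERATOR AT A COMPLEX POTENTIAL** `A₀ + diag w`, `w : X → ℂ` (the King-model analogue of Bałaban's complexified configuration).
[cite: King1986, (2.13)–(2.14) p.653, (4.5) p.670 (A = 0); Balaban1985BackgroundPropagators, Thm 3.4 p.400 (template)] -/
def fineOpCPot (w : Tor (fine N U) → ℂ) : Matrix (Tor (fine N U)) (Tor (fine N U)) ℂ :=
  (fineOp N U a c m2).map Complex.ofReal + Matrix.diagonal w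

/-- **KING'S EFFECTIVE LAPLACIAN AT A COMPLEX POTENTIAL** `Δ_eff(w) = a·1 − a²N^{d+1}·Q(A₀ + diag w)⁻¹Qᵀ` (junk value of `Matrix.inv` outside `‖w‖_∞ < m²`).
[cite: King1986, (2.13)–(2.14) p.653, (4.5) p.670 (A = 0)] -/
def effLaplacianCPot (w : Tor (fine N U) → ℂ) : Matrix (Tor U) (Tor U) ℂ :=
  (a : ℂ) • (1 : Matrix (Tor U) (Tor U) ℂ)
    - ((a ^ 2 * (N : ℝ) ^ (d + 1) : ℝ) : ℂ) • ((Qmat N U).map Complex.ofReal * (fineOpCPot N U a c m2 w)⁻¹ * ((Qmat N U).map Complex.ofReal)ᵀ)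

variable {N U a c m2}

/-- 28b's complex-coupling operator is the restriction to the complex line through a real potential: `A₀ + z·diag w = fineOpCPot (z·w)`. [folklore] -/
theorem fineOpCPot_smul (z : ℂ) (w : Tor (fine N U) → ℝ) :
    fineOpCPot N U a c m2 (fun x => z * (w x : ℂ)) = fineOpPotC N U a c m2 z w := by
  rw [fineOpCPot, fineOpPotC]
  congr 1
  ext i j
  simp only [Matrix.diagonal_apply, Matrix.smul_apply, smul_eq_mul]
  split_ifs <;> simp

/-- Likewise for the effective Laplacian. [folklore] -/
theorem effLaplacianCPot_smul (z : ℂ) (w : Tor (fine N U) → ℝ) :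
    effLaplacianCPot N U a c m2 (fun x => z * (w x : ℂ)) = effLaplacianPotC N U a c m2 z w := by
  rw [effLaplacianCPot, effLaplacianPotC, fineOpCPot_smul]

/-- **`A₀ + diag w` IS `Re`-COERCIVE with constant `m² − w₀`** for every complex potential with `‖w x‖ ≤ w₀`. [cite: King1986, (4.5) p.670 (A₀ ≥ m², A = 0)] -/
theorem reCoercive_fineOpCPot (ha : 0 ≤ a) (hc : 0 ≤ c) {w : Tor (fine N U) → ℂ} {w₀ : ℝ} (hw : ∀ x, ‖w x‖ ≤ w₀) (x : Tor (fine N U) → ℂ) :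
    (m2 - w₀) * nsq x ≤ (star x ⬝ᵥ fineOpCPot N U a c m2 w *ᵥ x).re :=
  reCoercive_add_of_norm_form_le (reCoercive_map_ofReal (fineOp_coercive N U m2 ha hc)) (norm_form_diagonal_le hw) x

/-- Inside the sup-ball `w₀ < m²` the complex fine operator has invertible determinant. [folklore] -/
theorem isUnit_det_fineOpCPot (ha : 0 ≤ a) (hc : 0 ≤ c) {w : Tor (fine N U) → ℂ} {w₀ : ℝ} (hw : ∀ x, ‖w x‖ ≤ w₀) (hw₀ : w₀ < m2) :
    IsUnit (fineOpCPot N U a c m2 w).det :=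
  isUnit_det_of_reCoercive (by linarith) (reCoercive_fineOpCPot ha hc hw)

/-- The entries of `w ↦ A₀ + diag w` are analytic in the complex potential. [folklore] -/
theorem analyticAt_fineOpCPot_apply (w₀ : Tor (fine N U) → ℂ) (i j : Tor (fine N U)) :
    AnalyticAt ℂ (fun w => fineOpCPot N U a c m2 w i j) w₀ := by
  unfold fineOpCPot
  simp only [Matrix.add_apply, Matrix.map_apply, Matrix.diagonal_apply]
  by_cases hij : i = j
  · simp only [if_pos hij]
    exact analyticAt_const.add (analyticAt_apply_coord i w₀)
  · simp only [if_neg hij, add_zero]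
    exact analyticAt_const

/-- **EVERY ENTRY OF KING'S EFFECTIVE LAPLACIAN IS AN ANALYTIC FUNCTION OF THE COMPLEX POTENTIAL** on the open sup-ball `‖w x‖ ≤ w₀ < m²`.
[cite: Balaban1985BackgroundPropagators, Thm 3.4 p.400 (template); King1986, (2.14) p.653] -/
theorem analyticAt_effLaplacianCPot_apply (ha : 0 ≤ a) (hc : 0 ≤ c) {w : Tor (fine N U) → ℂ} {w₀ : ℝ} (hw : ∀ x, ‖w x‖ ≤ w₀) (hw₀ : w₀ < m2)
    (b b' : Tor U) : AnalyticAt ℂ (fun w => effLaplacianCPot N U a c m2 w b b') w := by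
  have hF : ∀ x y, AnalyticAt ℂ (fun w => (fineOpCPot N U a c m2 w)⁻¹ x y) w := fun x y =>
    analyticAt_inv_apply_of_entries (fun i j => analyticAt_fineOpCPot_apply w i j) (isUnit_det_fineOpCPot ha hc hw hw₀) x y
  unfold effLaplacianCPot
  simp only [Matrix.sub_apply, Matrix.smul_apply, Matrix.mul_apply, Matrix.map_apply, Matrix.transpose_apply, smul_eq_mul]
  refine analyticAt_const.sub (analyticAt_const.mul ?_)
  refine Finset.analyticAt_fun_sum _ fun y _ => ?_
  refine (Finset.analyticAt_fun_sum _ fun x _ => ?_).mul analyticAt_const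
  exact analyticAt_const.mul (hF x y)

/-- **THE FORM BOUND AT A COMPLEX POTENTIAL — (3.64)–(3.65) OF [B9] IN KING'S MODEL**: for `a, c ≥ 0`, `m² > 0`, `‖w x‖ ≤ w₀ ≤ m²∕2`,
`‖⟨x̄, (Δ_eff(w) − Δ_eff(0))x⟩‖ ≤ (2a²∕m⁴)·w₀·nsq x`. [cite: Balaban1985BackgroundPropagators, (3.64)–(3.65) p.402 (template); King1986, (2.14) p.653, (4.5) p.670] -/
theorem norm_form_effLaplacianCPot_sub_le (ha : 0 ≤ a) (hc : 0 ≤ c) (hm : 0 < m2) {w : Tor (fine N U) → ℂ} {w₀ : ℝ} (hw₀ : 0 ≤ w₀)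
    (hw : ∀ x, ‖w x‖ ≤ w₀) (hwm : w₀ ≤ m2 / 2) (x : Tor U → ℂ) :
    ‖star x ⬝ᵥ (effLaplacianCPot N U a c m2 w - effLaplacianCPot N U a c m2 0) *ᵥ x‖ ≤ (2 * a ^ 2 / m2 ^ 2 * w₀) * nsq x := by
  set Qc := (Qmat N U).map Complex.ofReal with hQc
  set S := fineOpCPot N U a c m2 w with hSdef
  set S0 := fineOpCPot N U a c m2 0 with hS0def
  have hS : ∀ x, (m2 / 2) * nsq x ≤ (star x ⬝ᵥ S *ᵥ x).re := reCoercive_mono (reCoercive_fineOpCPot ha hc hw) (by linarith)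
  have hS0 : ∀ x, m2 * nsq x ≤ (star x ⬝ᵥ S0 *ᵥ x).re := by
    have h := reCoercive_fineOpCPot (N := N) (U := U) (a := a) (c := c) (m2 := m2) ha hc (w := 0) (w₀ := 0) (fun x => by simp)
    simpa only [sub_zero] using h
  have hm2 : 0 < m2 / 2 := by linarith
  have hSu : IsUnit S.det := isUnit_det_of_reCoercive hm2 hS
  have hS0u : IsUnit S0.det := isUnit_det_of_reCoercive hm hS0
  have hdiff : S0 - S = -Matrix.diagonal w := by
    rw [hSdef, hS0def, fineOpCPot, fineOpCPot]
    ext i j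
    by_cases h : i = j <;> simp [h]
  have hsub : effLaplacianCPot N U a c m2 w - effLaplacianCPot N U a c m2 0
      = -(((a ^ 2 * (N : ℝ) ^ (d + 1) : ℝ) : ℂ) • (Qc * (S⁻¹ - S0⁻¹) * Qcᵀ)) := by
    simp only [effLaplacianCPot, hQc, hSdef, hS0def, Matrix.mul_sub, Matrix.sub_mul, smul_sub]
    abel
  rw [hsub, Matrix.neg_mulVec, dotProduct_neg, norm_neg, form_smul_sandwich, inv_sub_inv_eq hSu hS0u, hdiff, norm_mul, ← Matrix.mulVec_mulVec,
    ← Matrix.mulVec_mulVec]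
  set y := Qcᵀ *ᵥ x with hy
  set u := (-Matrix.diagonal w) *ᵥ (S0⁻¹ *ᵥ y) with hu
  have hcoeff : ‖(((a ^ 2 * (N : ℝ) ^ (d + 1) : ℝ)) : ℂ)‖ = a ^ 2 * (N : ℝ) ^ (d + 1) := Complex.norm_of_nonneg (by positivity)
  have h1 : ‖star y ⬝ᵥ S⁻¹ *ᵥ u‖ ≤ (m2 / 2)⁻¹ * (Real.sqrt (nsq y) * Real.sqrt (nsq u)) := norm_star_dotProduct_inv_mulVec_le hm2 hS y u
  have h2 : Real.sqrt (nsq u) ≤ w₀ * (m2⁻¹ * Real.sqrt (nsq y)) := by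
    rw [hu, Matrix.neg_mulVec, nsq_neg]
    exact (sqrt_nsq_diagonal_mulVec_le hw₀ hw _).trans (mul_le_mul_of_nonneg_left (sqrt_nsq_inv_mulVec_le hm hS0 y) hw₀)
  have h3 : ‖star y ⬝ᵥ S⁻¹ *ᵥ u‖ ≤ (m2 / 2)⁻¹ * (w₀ * m2⁻¹) * nsq y := by
    calc ‖star y ⬝ᵥ S⁻¹ *ᵥ u‖ ≤ (m2 / 2)⁻¹ * (Real.sqrt (nsq y) * Real.sqrt (nsq u)) := h1
      _ ≤ (m2 / 2)⁻¹ * (Real.sqrt (nsq y) * (w₀ * (m2⁻¹ * Real.sqrt (nsq y)))) :=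
          mul_le_mul_of_nonneg_left (mul_le_mul_of_nonneg_left h2 (Real.sqrt_nonneg _)) (inv_nonneg.mpr hm2.le)
      _ = (m2 / 2)⁻¹ * (w₀ * m2⁻¹) * (Real.sqrt (nsq y) * Real.sqrt (nsq y)) := by ring
      _ = (m2 / 2)⁻¹ * (w₀ * m2⁻¹) * nsq y := by rw [sqrt_nsq_mul_self]
  have hyx : nsq y = (((N : ℕ) : ℝ) ^ (d + 1))⁻¹ * nsq x := nsq_transpose_QmatC_mulVec x
  have hN : (((N : ℕ) : ℝ) ^ (d + 1)) ≠ 0 := pow_ne_zero _ (Nat.cast_ne_zero.mpr (NeZero.ne N))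
  rw [hcoeff]
  calc a ^ 2 * (N : ℝ) ^ (d + 1) * ‖star y ⬝ᵥ S⁻¹ *ᵥ u‖
      ≤ a ^ 2 * (N : ℝ) ^ (d + 1) * ((m2 / 2)⁻¹ * (w₀ * m2⁻¹) * nsq y) := mul_le_mul_of_nonneg_left h3 (by positivity)
    _ = (2 * a ^ 2 / m2 ^ 2 * w₀) * nsq x := by
        rw [hyx]
        field_simp

end Fine

/-! ## §3 King's levels and dressed covariances at a complex potential: the inequalities, and ANALYTICITY -/

section King

variable (d) (a m2 : ℝ) (L : ℕ) [NeZero L] (M : Fin (d + 1) → ℕ) [∀ μ, NeZero (M μ)]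

/-- **KING'S LEVEL-`k` EFFECTIVE LAPLACIAN AT A COMPLEX POTENTIAL** `Δ^{(k)}_w`. [cite: King1986, (2.13)–(2.14) p.653, (4.5) p.670 (A = 0)] -/
def kingLevelCPot (k : ℕ) (w : Tor (fine (L ^ k) (fine L M)) → ℂ) : Matrix (Tor (fine L M)) (Tor (fine L M)) ℂ :=
  effLaplacianCPot (L ^ k) (fine L M) (aK a L k) (((L ^ k : ℕ) : ℝ) ^ 2) m2 w

/-- **THE DRESSED COVARIANCE AT A COMPLEX POTENTIAL** `C^{(k)}_w = (Δ^{(k)}_w + aL⁻²Q*Q)⁻¹`. [cite: King1986, (4.32) p.674 (A = 0 template)] -/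
def kingCovCPot (k : ℕ) (w : Tor (fine (L ^ k) (fine L M)) → ℂ) : Matrix (Tor (fine L M)) (Tor (fine L M)) ℂ :=
  (kingLevelCPot d a m2 L M k w + (kingBlock a L M).map Complex.ofReal)⁻¹

variable {d a m2 L M}

/-- 28b's complex-coupling covariance is the restriction to the complex line: `C^{(k)}_{z·w} = kingCovCPot k (z·w)`. [folklore] -/
theorem kingCovCPot_smul (k : ℕ) (z : ℂ) (w : Tor (fine (L ^ k) (fine L M)) → ℝ) :
    kingCovCPot d a m2 L M k (fun x => z * (w x : ℂ)) = kingCovPotC d a m2 L M k z w := by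
  rw [kingCovCPot, kingCovPotC, kingLevelCPot, kingLevelPotC, effLaplacianCPot_smul]

/-- At the zero potential the complex level is King's `Δ^{(k)}` read over ℂ. [folklore] -/
theorem kingLevelCPot_zero (k : ℕ) : kingLevelCPot d a m2 L M k 0 = (kingLevel a m2 L M k).map Complex.ofReal := by
  have h : kingLevelCPot d a m2 L M k (fun x => (0 : ℂ) * ((fun _ => (0 : ℝ)) x : ℂ)) = kingLevelPotC d a m2 L M k 0 (fun _ => 0) := by
    rw [kingLevelCPot, kingLevelPotC, effLaplacianCPot_smul]
  simp only [zero_mul] at h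
  rw [show (0 : Tor (fine (L ^ k) (fine L M)) → ℂ) = fun _ => 0 from rfl, h, kingLevelPotC_zero]

/-- **`Re`-COERCIVITY OF `Δ^{(k)}_w + aL⁻²Q*Q` AT A COMPLEX POTENTIAL**: `γ₀ − (2a²∕m⁴)·w₀` for `‖w x‖ ≤ w₀ ≤ m²∕2` (`L ≥ 2`, `a, m² > 0`, `k ≥ 1`).
[cite: King1986, (4.33) p.674 (A = 0); Balaban1985BackgroundPropagators, Thm 3.4 p.400 (template)] -/
theorem reCoercive_kingLevelCPot_add_block (ha : 0 < a) (hm : 0 < m2) (hL : 2 ≤ L) {k : ℕ} (hk : 1 ≤ k)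
    {w : Tor (fine (L ^ k) (fine L M)) → ℂ} {w₀ : ℝ} (hw₀ : 0 ≤ w₀) (hw : ∀ x, ‖w x‖ ≤ w₀) (hwm : w₀ ≤ m2 / 2) (x : Tor (fine L M) → ℂ) :
    (gam0L (d + 1) a L - 2 * a ^ 2 / m2 ^ 2 * w₀) * nsq x
      ≤ (star x ⬝ᵥ (kingLevelCPot d a m2 L M k w + (kingBlock a L M).map Complex.ofReal) *ᵥ x).re := by
  have hdec : kingLevelCPot d a m2 L M k w + (kingBlock a L M).map Complex.ofReal
      = (kingLevel a m2 L M k + kingBlock a L M).map Complex.ofReal + (kingLevelCPot d a m2 L M k w - kingLevelCPot d a m2 L M k 0) := by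
    rw [map_ofReal_add, ← kingLevelCPot_zero]
    abel
  rw [hdec]
  have hreal : Coercive (kingLevel a m2 L M k + kingBlock a L M) (gam0L (d + 1) a L) := by
    have h := uniformCoercive_kingTower (M := M) ha hm hL k
    rwa [kingTower_of_one_le hk] at h
  refine reCoercive_add_of_norm_form_le (reCoercive_map_ofReal hreal) (fun x => ?_) x
  have hLr : (1 : ℝ) < L := by exact_mod_cast (by omega : 1 < L)
  have haK := aK_pos ha hLr hk
  have haKle := aK_le ha hLr hk
  have h := norm_form_effLaplacianCPot_sub_le (N := L ^ k) (U := fine L M) (a := aK a L k) (c := ((L ^ k : ℕ) : ℝ) ^ 2) (m2 := m2)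
    haK.le (by positivity) hm hw₀ hw hwm x
  refine h.trans (mul_le_mul_of_nonneg_right ?_ (nsq_nonneg x))
  have hsq : aK a L k ^ 2 ≤ a ^ 2 := pow_le_pow_left₀ haK.le haKle 2
  have hm2 : 0 < m2 ^ 2 := by positivity
  rw [show 2 * aK a L k ^ 2 / m2 ^ 2 * w₀ = aK a L k ^ 2 * (2 / m2 ^ 2 * w₀) by ring,
    show 2 * a ^ 2 / m2 ^ 2 * w₀ = a ^ 2 * (2 / m2 ^ 2 * w₀) by ring]
  exact mul_le_mul_of_nonneg_right hsq (by positivity)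

/-- On the closed sup-ball `‖w x‖ ≤ w₀ ≤ r_K` the constant is `γ₀∕2`. [cite: King1986, (4.33) p.674 (A = 0 template)] -/
theorem reCoercive_kingLevelCPot_add_block_window (ha : 0 < a) (hm : 0 < m2) (hL : 2 ≤ L) {k : ℕ} (hk : 1 ≤ k)
    {w : Tor (fine (L ^ k) (fine L M)) → ℂ} {w₀ : ℝ} (hw₀ : 0 ≤ w₀) (hw : ∀ x, ‖w x‖ ≤ w₀) (hwK : w₀ ≤ cplxWindow d a m2 L)
    (x : Tor (fine L M) → ℂ) :
    (gam0L (d + 1) a L / 2) * nsq x ≤ (star x ⬝ᵥ (kingLevelCPot d a m2 L M k w + (kingBlock a L M).map Complex.ofReal) *ᵥ x).re := by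
  have h1 : w₀ ≤ m2 / 2 := hwK.trans (min_le_left _ _)
  have h2 : w₀ ≤ gam0L (d + 1) a L * m2 ^ 2 / (4 * a ^ 2) := hwK.trans (min_le_right _ _)
  refine reCoercive_mono (reCoercive_kingLevelCPot_add_block ha hm hL hk hw₀ hw h1) ?_ x
  have hm2 : 0 < m2 ^ 2 := by positivity
  have ha2 : 0 < a ^ 2 := by positivity
  have h3 : 2 * a ^ 2 / m2 ^ 2 * w₀ ≤ 2 * a ^ 2 / m2 ^ 2 * (gam0L (d + 1) a L * m2 ^ 2 / (4 * a ^ 2)) :=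
    mul_le_mul_of_nonneg_left h2 (by positivity)
  have h4 : 2 * a ^ 2 / m2 ^ 2 * (gam0L (d + 1) a L * m2 ^ 2 / (4 * a ^ 2)) = gam0L (d + 1) a L / 2 := by
    field_simp
    ring
  linarith

/-- Invertible determinant on the window. [folklore] -/
theorem isUnit_det_kingLevelCPot_add_block (ha : 0 < a) (hm : 0 < m2) (hL : 2 ≤ L) {k : ℕ} (hk : 1 ≤ k)
    {w : Tor (fine (L ^ k) (fine L M)) → ℂ} {w₀ : ℝ} (hw₀ : 0 ≤ w₀) (hw : ∀ x, ‖w x‖ ≤ w₀) (hwK : w₀ ≤ cplxWindow d a m2 L) :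
    IsUnit (kingLevelCPot d a m2 L M k w + (kingBlock a L M).map Complex.ofReal).det :=
  isUnit_det_of_reCoercive (half_pos (gam0L_pos (d := d + 1) ha hL)) (reCoercive_kingLevelCPot_add_block_window ha hm hL hk hw₀ hw hwK)

/-- ★★ **«THE EXTENDED OPERATORS SATISFY THE INEQUALITIES» — k-UNIFORM BOUND ON THE COMPLEX SUP-BALL**: for `L ≥ 2`, `a, m² > 0`, `k ≥ 1`, every volume
and every COMPLEX potential with `‖w x‖ ≤ w₀ ≤ r_K`: `‖C^{(k)}_w(x,y)‖ ≤ 2∕γ₀`. [cite: Balaban1985BackgroundPropagators, Thm 3.4 p.400 (template); King1986, (4.33)–(4.34) p.674 (A = 0)] -/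
theorem kingCovCPot_apply_norm_le (ha : 0 < a) (hm : 0 < m2) (hL : 2 ≤ L) {k : ℕ} (hk : 1 ≤ k)
    {w : Tor (fine (L ^ k) (fine L M)) → ℂ} {w₀ : ℝ} (hw₀ : 0 ≤ w₀) (hw : ∀ x, ‖w x‖ ≤ w₀) (hwK : w₀ ≤ cplxWindow d a m2 L)
    (x y : Tor (fine L M)) : ‖kingCovCPot d a m2 L M k w x y‖ ≤ 2 / gam0L (d + 1) a L := by
  have hγ := gam0L_pos (d := d + 1) ha hL
  have h := inv_entry_norm_le_of_reCoercive (half_pos hγ) (reCoercive_kingLevelCPot_add_block_window ha hm hL hk hw₀ hw hwK) x y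
  rw [kingCovCPot]
  rwa [inv_div] at h

/-- ★★ **EVERY ENTRY OF THE LEVEL `w ↦ Δ^{(k)}_w(b,b′)` IS ANALYTIC IN THE COMPLEX POTENTIAL** on the sup-ball `‖w x‖ ≤ w₀ < m²` (`L ≥ 2`, `a, m² > 0`, `k ≥ 1`).
[cite: Balaban1985BackgroundPropagators, Thm 3.4 p.400 (template); King1986, (2.14) p.653] -/
theorem analyticAt_kingLevelCPot_apply (ha : 0 < a) (hL : 2 ≤ L) {k : ℕ} (hk : 1 ≤ k) {w : Tor (fine (L ^ k) (fine L M)) → ℂ} {w₀ : ℝ}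
    (hw : ∀ x, ‖w x‖ ≤ w₀) (hw₀ : w₀ < m2) (b b' : Tor (fine L M)) :
    AnalyticAt ℂ (fun w => kingLevelCPot d a m2 L M k w b b') w := by
  have hLr : (1 : ℝ) < L := by exact_mod_cast (by omega : 1 < L)
  have haK := aK_pos ha hLr hk
  exact analyticAt_effLaplacianCPot_apply haK.le (by positivity) hw hw₀ b b'

/-- ★★★ **[B9] THEOREM 3.4 IN KING'S MODEL, MULTI-VARIABLE FORM — EVERY ENTRY OF THE DRESSED COVARIANCE `w ↦ C^{(k)}_w(x,y)` IS AN ANALYTIC FUNCTION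
OF THE COMPLEX POTENTIAL** at every point of the closed sup-ball `‖w x‖ ≤ w₀ ≤ r_K` (jointly in all the `N^{d+1}·|Π ℤ∕(LM_μ)|` complex variables; the
entries of `Δ^{(k)}_w + aL⁻²Q*Q` are analytic by §2 and the matrix is invertible by (4.33) read over ℂ; Cramer's rule, §1).
[cite: Balaban1985BackgroundPropagators, Thm 3.4 p.400, (3.64)–(3.65) p.402 (template); King1986, (4.32)–(4.33) p.674 (A = 0)] -/
theorem analyticAt_kingCovCPot_apply (ha : 0 < a) (hm : 0 < m2) (hL : 2 ≤ L) {k : ℕ} (hk : 1 ≤ k)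
    {w : Tor (fine (L ^ k) (fine L M)) → ℂ} {w₀ : ℝ} (hw₀ : 0 ≤ w₀) (hw : ∀ x, ‖w x‖ ≤ w₀) (hwK : w₀ ≤ cplxWindow d a m2 L)
    (x y : Tor (fine L M)) : AnalyticAt ℂ (fun w => kingCovCPot d a m2 L M k w x y) w := by
  have hwm : w₀ < m2 := lt_of_le_of_lt (hwK.trans (min_le_left _ _)) (by linarith)
  unfold kingCovCPot
  refine analyticAt_inv_apply_of_entries (M := fun w => kingLevelCPot d a m2 L M k w + (kingBlock a L M).map Complex.ofReal)
    (fun i j => ?_) (isUnit_det_kingLevelCPot_add_block ha hm hL hk hw₀ hw hwK) x y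
  simp only [Matrix.add_apply]
  exact (analyticAt_kingLevelCPot_apply ha hL hk hw hwm i j).add analyticAt_const

/-- **ANALYTIC ON THE OPEN SUP-BALL**: for `L ≥ 2`, `a, m² > 0`, `k ≥ 1`, every entry `w ↦ C^{(k)}_w(x,y)` is `AnalyticOnNhd ℂ` on
`{w | ‖w‖ < r_K}` (sup norm), where it is bounded by `2∕γ₀` — uniformly in `k` and the volume. [cite: Balaban1985BackgroundPropagators, Thm 3.4 p.400 (template)] -/
theorem analyticOnNhd_kingCovCPot_apply (ha : 0 < a) (hm : 0 < m2) (hL : 2 ≤ L) {k : ℕ} (hk : 1 ≤ k) (x y : Tor (fine L M)) :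
    AnalyticOnNhd ℂ (fun w : Tor (fine (L ^ k) (fine L M)) → ℂ => kingCovCPot d a m2 L M k w x y) {w | ‖w‖ < cplxWindow d a m2 L} ∧
      ∀ w : Tor (fine (L ^ k) (fine L M)) → ℂ, ‖w‖ < cplxWindow d a m2 L → ‖kingCovCPot d a m2 L M k w x y‖ ≤ 2 / gam0L (d + 1) a L := by
  refine ⟨fun w hw => ?_, fun w hw => ?_⟩
  · exact analyticAt_kingCovCPot_apply ha hm hL hk (norm_nonneg w) (fun x => norm_apply_le_pi_norm w x) (le_of_lt hw) x y
  · exact kingCovCPot_apply_norm_le ha hm hL hk (norm_nonneg w) (fun x => norm_apply_le_pi_norm w x) (le_of_lt hw) x y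

end King

end Summit.QuantumFields.YangMills.BalabanUVNodes.N15.KingModel

end
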